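import Summits.SmoothPoincare4.SmoothPoincare4.Theses.CongruenceShadows

/-!
# Line `weakly-reducible-knot-rigidity` — crux `CongruenceShadows.ShadowApproximation`
(stmt-SmoothPoincare4-14595), the `m = 0` rung (genus 3, type `(3;1,1,1)`)

Skeleton (crux-plan, round 1) for the idea card `weakly-reducible-knot-rigidity`
(Aranda–Zupan 2025, arXiv:2503.04607, + profinite rigidity of 3-manifold groups), sharpened by
the triage TRIAGE-r1-1 (depth-2 lattice words are blind; scc-hulls need level coherence; the
dictionary K1 must name ONE shadow-determined datum).

## The datum (this seat's sharpening of the card's `𝔊_{α;βγ}`)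

For a genus-3 kernel triple `K` with lone slot `i` and a non-separating simple closed curve
`c` bounding discs in the two OTHER handlebodies (`c ∈ K j ⊓ K k`), the **surgered handlebody
group** is `S₃ ⧸ (K i ⊔ ⟪c⟫) = π₁(H_i ∪ 2-handle along c) = F₃ ⧸ ⟪w⟫` — the group of a COMPACT
3-MANIFOLD. On Aranda–Zupan's weakly-reducible stratum (their normal form `β₃ = γ₃ = c`,
`α₁ ∩ c = ∅`, `|α₁ ∩ β₁| = |α₁ ∩ γ₁| = 1`, Prop. 3.9) it is `π₁(S¹×S² ∖ K) ∗ ℤ` for the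
tunnel-number-one knot `K` of their Prop. 8.1 (`E(K) = H_α′ ∪ C`, `C = H_β′[c]`), so
"`K` is the core" ⟺ "the surgered group is free of rank 2" ⟺ "`c` is primitive in `H_i`"
(Whitehead 1936 + Gordon 1987) ⟹ "`T` is stabilised along `c`" (AZ25 p. 11) ⟹ standard
(Meier–Zupan + Gay–Kirby). For the standard triple `N = s4Kernels` and lone slot `i` the
reference curve is `loneRef i` (`a₃, a₂, a₁` for `i = 0, 1, 2`) and
`S₃ ⧸ (N i ⊔ ⟪loneRef i⟫) ≅ F₂`.

## Stubs (sorried, registered) and composition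

* `stub_weaklyReducible` — the stratum bet (AZ Q 8.3 for shadow-standard homotopy spheres).
* `stub_azNormalForm` — AZ25 Prop. 3.9 / Thm. 1.3 + MZ17 + GK16 + AGK Thm. 5, in group form.
* `stub_hullCoherence` — LOAD-BEARING: standard triple-shadows ⟹ the surgered handlebody
  group has standard shadows (level coherence of ONE reducing-curve hull).
* `stub_profiniteFreeness` — a compact-3-manifold group with the finite quotients of `F₂` is
  `F₂` (goodness + Long–Niblo + Grushko–Kneser; Wilton 2018 / Puder–Parzanchevski genre).
* `stub_primitiveDestabilisation` — surgered group free ⟹ `Iso N K` (Whitehead, Gordon,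
  AZ25 p. 11, MZ17b, GK16, AGK Thm. 5).
* `stub_higherRungs` — the rungs `m ≥ 1` are NOT this line's claim (junction with the sibling
  line `Lines/free-shadow-tsystem.lean`, whose composition covers `m ≥ 1` and whose residual
  `stub_twistLevel` at `m = 0` is exactly what THIS line attacks); stated shifted (`m + 1`).
* Composition (sorry-free): `genusThree_of_parts`, `ShadowApproximation_of`.
* Certificates (sorry-free, § Certificates): `standard_witness` (non-vacuity at `K = N`),
  explicit handle-swap automorphisms `swap02`, `swap01` of the one-relator group `S₃`, and
  `open_stubs_necessary`: the genus-3 gate (normalised + shadow-standard ⟹ `Iso N K`) implies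
  BOTH open stubs — they are necessary conditions of the crux at `m = 0`, so a refutation of
  either refutes `ShadowApproximation` at genus 3 (route kill criterion: restate stably).

Disproof.lean: none exists for this crux (payload `disproof_path` absent on this hub; `ledger crux
ls` 2026-08-16). Honoured instead (refuter crux-attack note 19:47Z + triage r1-1):
`IsGroupTrisection` is a hypothesis of every stub that concludes anything about `K`
(its `triple` field is used by `stub_azNormalForm`/`stub_primitiveDestabilisation` through
AGK Thm. 5: the trisected 4-manifold is a homotopy sphere); `hW`, `hS` are kept at full strength in
the two open stubs; `ledger negatives --problem SmoothPoincare4` = 0, so no stub restates a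
refuted statement; depth-2 lattice words (triage `KnotGroupCandidate.lean`: blind) are NOT used —
the datum is the 2-handle quotient along ONE curve, existentially chosen.
-/

noncomputable section

namespace Summit.SmoothPoincare4.SmoothPoincare4.Cruxes.ShadowApproximation.WeaklyReducibleKnotRigidity

set_option linter.dupNamespace false

open Literature.Topology.FourManifolds
open Summit.SmoothPoincare4.SmoothPoincare4.Theses.CongruenceShadows (ShadowApproximation)

/-! ## Vocabulary over `SurfaceGroup 3` (no new Literature definitions; all local) -/

/-- The genus-3 surface group `S₃ = π₁(Σ₃)`. -/
abbrev S : Type := SurfaceGroup 3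

/-- The standard genus-3 kernel triple of `S⁴` (`⟪a₁,a₂,b₃⟫, ⟪a₁,b₂,a₃⟫, ⟪b₁,a₂,a₃⟫`). -/
abbrev N : TrisectionKernels 3 := s4Kernels

/-- `c` is (the based class of) an oriented **non-separating simple closed curve**: it lies in
the `Aut(S₃)`-orbit of `a₁` (Dehn–Nielsen–Baer: `Aut π₁(Σ₃,*) = Homeo^±(Σ₃,*)`-classes, and based
non-separating simple loops form one orbit). -/
def IsCurve (c : S) : Prop :=
  ∃ φ : S ≃* S, φ c = SurfaceGroup.a 0

/-- `c` and `d` are **disjoint** curves (after isotopy): simultaneously, `c` is carried to `a₁`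
and `d` into (a conjugate of) the image `⟨a₁, a₂, b₂, a₃, b₃⟩` of `π₁(Σ₃ ∖ a₁)` (covers both the
mutually non-separating and the mutually separating type, and `d ∥ c`). -/
def AreDisjoint (c d : S) : Prop :=
  ∃ φ : S ≃* S, φ c = SurfaceGroup.a 0 ∧ ∃ x : S, x * φ d * x⁻¹ ∈
    Subgroup.closure ({SurfaceGroup.a 0, SurfaceGroup.a 1, SurfaceGroup.b 1, SurfaceGroup.a 2,
      SurfaceGroup.b 2} : Set S)

/-- **Weakly reducible** kernel triple (Aranda–Zupan 2025, §1, in group form): there are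
disjoint non-separating curves `c`, `d` with `c` bounding a disc in ONE handlebody (`c ∈ K i`,
Dehn's lemma) and `d` bounding discs in the other two. -/
def IsWeaklyReducible (K : TrisectionKernels 3) : Prop :=
  ∃ i j k : Fin 3, i ≠ j ∧ i ≠ k ∧ j ≠ k ∧ ∃ c d : S,
    c ∈ K i ∧ d ∈ K j ∧ d ∈ K k ∧ IsCurve c ∧ IsCurve d ∧ AreDisjoint c d

/-- **Aranda–Zupan knot normal form** with lone slot `i` and common curve `c` (AZ25 Prop. 3.9,
the irreducible weakly-reducible case, group form): `c` is a non-separating curve bounding discs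
in the two handlebodies other than `H_i` but not in `H_i`; there is an `H_i`-disc curve `α₁`,
and in each of the other two handlebodies a disc curve `β₁` (resp. `γ₁`), such that the curve
configuration `(α₁, c, β₁)` is standard: carried by one automorphism to `(a₁, a₃, b₁)` up to
conjugacy of the last two (free homotopy) — i.e. `α₁ ∩ c = ∅` mutually non-separating,
`|α₁ ∩ β₁| = 1`, `β₁ ∩ c = ∅` (AZ25 Prop. 3.9: `β₃ = γ₃ = c`, `|α₁ ∩ β₁| = |α₁ ∩ γ₁| = 1`). This
is the stratum of AZ25 Prop. 8.1 (`T = T(K, τ, λ)`, `K ⊂ S¹ × S²` of tunnel number one). -/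
def KnotNormalForm (i : Fin 3) (K : TrisectionKernels 3) (c : S) : Prop :=
  IsCurve c ∧ (∀ l : Fin 3, l ≠ i → c ∈ K l) ∧ c ∉ K i ∧
  ∃ α₁ : S, α₁ ∈ K i ∧ ∀ l : Fin 3, l ≠ i → ∃ β₁ : S, β₁ ∈ K l ∧
    ∃ φ : S ≃* S, φ α₁ = SurfaceGroup.a 0 ∧ (∃ x : S, x * φ c * x⁻¹ = SurfaceGroup.a 2) ∧
      ∃ y : S, y * φ β₁ * y⁻¹ = SurfaceGroup.b 0

/-- The reference common curve of the standard triple for lone slot `i`: `N 1 ⊓ N 2 ∋ a₃`,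
`N 0 ⊓ N 2 ∋ a₂`, `N 0 ⊓ N 1 ∋ a₁`; in each case `S₃ ⧸ (N i ⊔ ⟪loneRef i⟫) ≅ F₂`. -/
def loneRef : Fin 3 → S :=
  ![SurfaceGroup.a 2, SurfaceGroup.a 1, SurfaceGroup.a 0]

/-- The **surgered handlebody subgroup** `⟪K i ∪ {c}⟫ = K i ⊔ ⟪c⟫` (for `K i` normal): the
kernel of `S₃ = π₁(Σ₃) → π₁(H_i ∪ 2-handle along c)`; `S₃ ⧸ surgered K i c = F₃ ⧸ ⟪w⟫` with `w`
the image of `c` in `π₁(H_i) = F₃`. -/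
def surgered (K : TrisectionKernels 3) (i : Fin 3) (c : S) : Subgroup S :=
  Subgroup.normalClosure ((K i : Set S) ∪ {c})

/-- The surgered subgroup is normal (it is a normal closure). -/
instance surgered_normal (K : TrisectionKernels 3) (i : Fin 3) (c : S) : (surgered K i c).Normal := by
  unfold surgered; infer_instance

/-- **Standard surgered shadows**: in every characteristic finite quotient of `S₃`, the
surgered handlebody subgroup `surgered K i c = K i ⊔ ⟪c⟫` is the image of the standard one
under an automorphism of `S₃` — the level-wise form of "`π₁(H_i[c])` is profinitely `F₂`". -/
def SurgeredShadowsStandard (i : Fin 3) (K : TrisectionKernels 3) (c : S) : Prop :=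
  ∀ M : Subgroup S, M.Characteristic → M.FiniteIndex →
    ∃ ψ : S ≃* S, (surgered N i (loneRef i) ⊔ M).map ψ.toMonoidHom = surgered K i c ⊔ M

/-- The crux's Waldhausen normalisation hypothesis at genus 3 (`m = 0`). -/
def PairsNormalised (K : TrisectionKernels 3) : Prop :=
  ∀ i j : Fin 3, i ≠ j → ∃ α : S ≃* S, (N i).map α.toMonoidHom = K i ∧ (N j).map α.toMonoidHom = K j

/-- The crux's standard-shadow hypothesis at genus 3 (`m = 0`). -/
def TripleShadowsStandard (K : TrisectionKernels 3) : Prop :=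
  ∀ M : Subgroup S, M.Characteristic → M.FiniteIndex →
    ∃ ψ : S ≃* S, ∀ i : Fin 3, (N i ⊔ M).map ψ.toMonoidHom = K i ⊔ M

/-! ## Statements of the stubs -/

/-- Statement of `stub_weaklyReducible` (the STRATUM BET): a Waldhausen-normalised `(3;1,1,1)`
group trisection of the trivial group with standard finite shadows is weakly reducible — no
strongly irreducible shadow-standard genus-3 trisection of a homotopy 4-sphere (AZ25 Q 8.3 on the
shadow-standard locus). Necessary for the crux at `m = 0` (`N` is weakly reducible and `Iso`
transports weak reductions). -/
def WeakReduction : Prop :=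
  ∀ K : TrisectionKernels 3, IsGroupTrisection 3 1 (PUnit : Type) K → PairsNormalised K →
    TripleShadowsStandard K → IsWeaklyReducible K

/-- Statement of `stub_azNormalForm` (Aranda–Zupan in group form): a weakly reducible
`(3;1,1,1)` group trisection of the trivial group is standard, or is in knot normal form for
some lone slot (AZ25 Prop. 3.9 and §6; reducible ⟹ genus `≤ 2` summands ⟹ standard by
Meier–Zupan 2017 + Gay–Kirby 2016; transported through AGK Thm. 5). -/
def AZNormalForm : Prop :=
  ∀ K : TrisectionKernels 3, IsGroupTrisection 3 1 (PUnit : Type) K → IsWeaklyReducible K →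
    TrisectionKernels.Iso N K ∨ ∃ (i : Fin 3) (c : S), KnotNormalForm i K c

/-- Statement of `stub_hullCoherence` (LOAD-BEARING, open): on the knot stratum, standard
triple-shadows force standard SURGERED shadows for some common curve — the level coherence of
one reducing-curve hull that the triple hypothesis `hS` does not hand over for free. -/
def HullCoherence : Prop :=
  ∀ (K : TrisectionKernels 3) (i : Fin 3) (c : S), IsGroupTrisection 3 1 (PUnit : Type) K →
    PairsNormalised K → TripleShadowsStandard K → KnotNormalForm i K c →
    ∃ c' : S, IsCurve c' ∧ (∀ l : Fin 3, l ≠ i → c' ∈ K l) ∧ SurgeredShadowsStandard i K c'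

/-- Statement of `stub_profiniteFreeness` (3-manifold profinite rigidity, group form): if the
surgered handlebody group `S₃ ⧸ (K i ⊔ ⟪c⟫) = π₁(H_i[c])` has standard shadows (hence the finite
quotients of `F₂`), it IS free of rank 2 (compact-3-manifold groups are good, peripheral
subgroups are separable, Grushko–Kneser; cf. Wilton 2018 Cor. 5 / Puder–Parzanchevski 2015). -/
def ProfiniteFreeness : Prop :=
  ∀ (K : TrisectionKernels 3) (i : Fin 3) (c : S), IsGroupTrisection 3 1 (PUnit : Type) K →
    IsCurve c → SurgeredShadowsStandard i K c →
    IsFreeOfRank (S ⧸ surgered K i c) 2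

/-- Statement of `stub_primitiveDestabilisation`: a non-separating curve bounding discs in two
handlebodies whose 2-handle addition to the third gives a free group of rank 2 is primitive there
(Whitehead 1936, Gordon 1987), so the trisection is stabilised along it (AZ25 p. 11) and, being a
homotopy-sphere trisection of genus 3 with a genus-`≤ 2` destabilisation, is the standard one
(MZ17b, GK16, AGK Thm. 5): `Iso N K`. -/
def PrimitiveDestabilisation : Prop :=
  ∀ (K : TrisectionKernels 3) (i : Fin 3) (c : S), IsGroupTrisection 3 1 (PUnit : Type) K →
    IsCurve c → (∀ l : Fin 3, l ≠ i → c ∈ K l) →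
    IsFreeOfRank (S ⧸ surgered K i c) 2 → TrisectionKernels.Iso N K

/-- Statement of `stub_higherRungs`: the rungs `m + 1 ≥ 1` of the crux (genus `6, 9, …`). NOT a
claim of this line — it is the junction with the sibling line `free-shadow-tsystem` (Nielsen
level + twist gate, which bites only from `m = 1` on); recorded so that the skeleton concludes
the crux by name. -/
def HigherRungs : Prop :=
  ∀ (m : ℕ) (K : TrisectionKernels (3 + 3 * (m + 1))),
    IsGroupTrisection (3 + 3 * (m + 1)) (m + 1 + 1) (PUnit : Type) K →
    (∀ i j : Fin 3, i ≠ j → ∃ α : SurfaceGroup (3 + 3 * (m + 1)) ≃* SurfaceGroup (3 + 3 * (m + 1)),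
      (s4Kernels.stabilizeIter (m + 1) i).map α.toMonoidHom = K i ∧
      (s4Kernels.stabilizeIter (m + 1) j).map α.toMonoidHom = K j) →
    (∀ M : Subgroup (SurfaceGroup (3 + 3 * (m + 1))), M.Characteristic → M.FiniteIndex →
      ∃ ψ : SurfaceGroup (3 + 3 * (m + 1)) ≃* SurfaceGroup (3 + 3 * (m + 1)), ∀ i : Fin 3,
        (s4Kernels.stabilizeIter (m + 1) i ⊔ M).map ψ.toMonoidHom = K i ⊔ M) →
    TrisectionKernels.Iso (s4Kernels.stabilizeIter (m + 1)) K

/-! ## Registered stubs -/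

/-- STUB 1 (size L–XL, conjectural; Heegaard-theoretic attack: thin position / Casson–Gordon as
in AZ25 §3, or a disc-complex distance argument using the level data of `hS`). -/
theorem stub_weaklyReducible : WeakReduction := by
  sorry

/-- STUB 2 (size XL to formalise, KNOWN in print: AZ25 Prop. 3.9 + §6 + MZ17b + GK16, through the
AGK Thm. 5 dictionary group trisection ↔ trisected homotopy sphere and DNB for `IsCurve`). -/
theorem stub_azNormalForm : AZNormalForm := by
  sorry

/-- STUB 3 (size XL, OPEN — the load-bearing bet of the line). -/
theorem stub_hullCoherence : HullCoherence := by
  sorry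

/-- STUB 4 (size L, known modulo assembling citations: Hom-counting ⟹ same finite quotients ⟹
`π̂₁(H_i[c]) ≅ F̂₂`; a compact 3-manifold group that is profinitely free is free). -/
theorem stub_profiniteFreeness : ProfiniteFreeness := by
  sorry

/-- STUB 5 (size L–XL to formalise, KNOWN in print: Whitehead 1936 (one-relator quotient free ⟹
relator primitive), Gordon 1987 (algebraic ⟹ geometric primitivity on `∂H`), destabilisation,
MZ17b/GK16 via `Literature.Barriers.SmoothPoincare4.mz_genus_le_two_homotopySphere_gk`, AGK). -/
theorem stub_primitiveDestabilisation : PrimitiveDestabilisation := by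
  sorry

/-- STUB 6 (out of this line's scope: the `m ≥ 1` rungs, owned by the sibling line). -/
theorem stub_higherRungs : HigherRungs := by
  sorry

/-! ## Composition (sorry-free) -/

/-- **The genus-3 rung from the five genus-3 parts** (pure logic): weak reduction ⟹ AZ normal
form or standard; on the knot stratum, hull coherence ⟹ surgered shadows standard ⟹ surgered
group free (profinite freeness) ⟹ standard (primitive destabilisation). -/
theorem genusThree_of_parts (h₁ : WeakReduction) (h₂ : AZNormalForm) (h₃ : HullCoherence)
    (h₄ : ProfiniteFreeness) (h₅ : PrimitiveDestabilisation)
    (K : TrisectionKernels 3) (hK : IsGroupTrisection 3 1 (PUnit : Type) K)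
    (hW : PairsNormalised K) (hS : TripleShadowsStandard K) : TrisectionKernels.Iso N K := by
  rcases h₂ K hK (h₁ K hK hW hS) with hIso | ⟨i, c, hNF⟩
  · exact hIso
  · obtain ⟨c', hc', hmem, hSh⟩ := h₃ K i c hK hW hS hNF
    exact h₅ K i c' hK hc' hmem (h₄ K i c' hK hc' hSh)

/-- **The skeleton concludes the crux BY NAME.** `ShadowApproximation` (route
`CongruenceShadows`, stmt-SmoothPoincare4-14595) from the six registered stubs: `m = 0` is the
genus-3 composition, `m + 1` is `stub_higherRungs`. -/
theorem ShadowApproximation_of : ShadowApproximation := by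
  intro m
  cases m with
  | zero =>
    intro K hK hW hS
    exact genusThree_of_parts stub_weaklyReducible stub_azNormalForm stub_hullCoherence
      stub_profiniteFreeness stub_primitiveDestabilisation K hK hW hS
  | succ m =>
    intro K hK hW hS
    exact stub_higherRungs m K hK hW hS

/-! ## Certificates (sorry-free): non-vacuity, and the two OPEN stubs are necessary

`stub_weaklyReducible` and `stub_hullCoherence` are implied by the crux's own conclusion pattern at
genus 3 (`gate`: normalised + shadow-standard ⟹ `Iso N K`), so neither is "more false than the
crux": a refutation of either is a refutation of `ShadowApproximation` at `m = 0`. The proofs need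
two explicit automorphisms of the one-relator group `S₃` (handle swaps with a conjugation fix). -/

section Certificates

/-- The commutator word `[a_k, b_k]` of handle `k` in `S₃`. -/
def hc (k : Fin 3) : S := SurfaceGroup.a k * SurfaceGroup.b k * (SurfaceGroup.a k)⁻¹ * (SurfaceGroup.b k)⁻¹

/-- The genus-3 relator spelled out: `[a₀,b₀]([a₁,b₁][a₂,b₂])`. -/
theorem surfaceRelator_three : surfaceRelator 3 =
    genA 0 * genB 0 * (genA 0)⁻¹ * (genB 0)⁻¹ * (genA 1 * genB 1 * (genA 1)⁻¹ * (genB 1)⁻¹ *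
      (genA 2 * genB 2 * (genA 2)⁻¹ * (genB 2)⁻¹)) := by
  simp [surfaceRelator, List.finRange_succ]

/-- The surface relation `[a₀,b₀][a₁,b₁][a₂,b₂] = 1` in `S₃`. -/
theorem rel_S : hc 0 * (hc 1 * hc 2) = 1 := by
  have h : PresentedGroup.mk ({surfaceRelator 3} : Set (FreeGroup (surfaceGen 3)))
      (genA 0 * genB 0 * (genA 0)⁻¹ * (genB 0)⁻¹ * (genA 1 * genB 1 * (genA 1)⁻¹ * (genB 1)⁻¹ *
        (genA 2 * genB 2 * (genA 2)⁻¹ * (genB 2)⁻¹))) = 1 := by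
    rw [← surfaceRelator_three]
    exact PresentedGroup.one_of_mem (Set.mem_singleton _)
  simpa [map_mul, map_inv, genA, genB, hc, SurfaceGroup.a, SurfaceGroup.b, PresentedGroup.of] using h

/-- An endomorphism of `S₃` from the images of the six generators, given the relator. -/
def endOfGens (f : surfaceGen 3 → S)
    (h : f (0, false) * f (0, true) * (f (0, false))⁻¹ * (f (0, true))⁻¹ *
      (f (1, false) * f (1, true) * (f (1, false))⁻¹ * (f (1, true))⁻¹ *
        (f (2, false) * f (2, true) * (f (2, false))⁻¹ * (f (2, true))⁻¹)) = 1) : S →* S :=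
  PresentedGroup.toGroup (f := f) (by
    intro r hr
    rw [Set.mem_singleton_iff] at hr
    subst hr
    have key : FreeGroup.lift f (genA 0 * genB 0 * (genA 0)⁻¹ * (genB 0)⁻¹ *
        (genA 1 * genB 1 * (genA 1)⁻¹ * (genB 1)⁻¹ * (genA 2 * genB 2 * (genA 2)⁻¹ * (genB 2)⁻¹))) = 1 := by
      simpa [map_mul, map_inv, genA, genB] using h
    rwa [← surfaceRelator_three] at key)

@[simp] theorem endOfGens_of (f : surfaceGen 3 → S) (h) (p : surfaceGen 3) :
    endOfGens f h (PresentedGroup.of p) = f p :=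
  PresentedGroup.toGroup.of _

/-- Generator images of the handle swap `0 ↔ 2` (handle `1` conjugated by `[a₀,b₀]`). -/
def swap02Gen : surfaceGen 3 → S
  | (0, false) => SurfaceGroup.a 2
  | (0, true) => SurfaceGroup.b 2
  | (1, false) => hc 0 * SurfaceGroup.a 1 * (hc 0)⁻¹
  | (1, true) => hc 0 * SurfaceGroup.b 1 * (hc 0)⁻¹
  | (2, false) => SurfaceGroup.a 0
  | (2, true) => SurfaceGroup.b 0

/-- Generator images of the inverse of `swap02Gen` (handle `1` conjugated by `[a₂,b₂]⁻¹`). -/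
def swap02InvGen : surfaceGen 3 → S
  | (0, false) => SurfaceGroup.a 2
  | (0, true) => SurfaceGroup.b 2
  | (1, false) => (hc 2)⁻¹ * SurfaceGroup.a 1 * hc 2
  | (1, true) => (hc 2)⁻¹ * SurfaceGroup.b 1 * hc 2
  | (2, false) => SurfaceGroup.a 0
  | (2, true) => SurfaceGroup.b 0

/-- Generator images of the handle swap `0 ↔ 1` (handle `2` conjugated by `[a₀,b₀]⁻¹`). -/
def swap01Gen : surfaceGen 3 → S
  | (0, false) => SurfaceGroup.a 1
  | (0, true) => SurfaceGroup.b 1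
  | (1, false) => SurfaceGroup.a 0
  | (1, true) => SurfaceGroup.b 0
  | (2, false) => (hc 0)⁻¹ * SurfaceGroup.a 2 * hc 0
  | (2, true) => (hc 0)⁻¹ * SurfaceGroup.b 2 * hc 0

/-- Generator images of the inverse of `swap01Gen` (handle `2` conjugated by `[a₁,b₁]`). -/
def swap01InvGen : surfaceGen 3 → S
  | (0, false) => SurfaceGroup.a 1
  | (0, true) => SurfaceGroup.b 1
  | (1, false) => SurfaceGroup.a 0
  | (1, true) => SurfaceGroup.b 0
  | (2, false) => hc 1 * SurfaceGroup.a 2 * (hc 1)⁻¹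
  | (2, true) => hc 1 * SurfaceGroup.b 2 * (hc 1)⁻¹

theorem swap02Gen_rel : swap02Gen (0, false) * swap02Gen (0, true) * (swap02Gen (0, false))⁻¹ *
    (swap02Gen (0, true))⁻¹ * (swap02Gen (1, false) * swap02Gen (1, true) *
    (swap02Gen (1, false))⁻¹ * (swap02Gen (1, true))⁻¹ * (swap02Gen (2, false) *
    swap02Gen (2, true) * (swap02Gen (2, false))⁻¹ * (swap02Gen (2, true))⁻¹)) = 1 := by
  have h := rel_S
  simp only [hc] at h ⊢
  -- the word equals `[a₂,b₂][a₀,b₀][a₁,b₁]`, a conjugate of the relator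
  calc _ = (SurfaceGroup.a 2 * SurfaceGroup.b 2 * (SurfaceGroup.a 2)⁻¹ * (SurfaceGroup.b 2)⁻¹) *
        (SurfaceGroup.a 0 * SurfaceGroup.b 0 * (SurfaceGroup.a 0)⁻¹ * (SurfaceGroup.b 0)⁻¹ *
          (SurfaceGroup.a 1 * SurfaceGroup.b 1 * (SurfaceGroup.a 1)⁻¹ * (SurfaceGroup.b 1)⁻¹ *
            (SurfaceGroup.a 2 * SurfaceGroup.b 2 * (SurfaceGroup.a 2)⁻¹ * (SurfaceGroup.b 2)⁻¹))) *
        (SurfaceGroup.a 2 * SurfaceGroup.b 2 * (SurfaceGroup.a 2)⁻¹ * (SurfaceGroup.b 2)⁻¹)⁻¹ := by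
          simp only [swap02Gen, hc]; group
    _ = 1 := by rw [h]; group

theorem swap02InvGen_rel : swap02InvGen (0, false) * swap02InvGen (0, true) *
    (swap02InvGen (0, false))⁻¹ * (swap02InvGen (0, true))⁻¹ * (swap02InvGen (1, false) *
    swap02InvGen (1, true) * (swap02InvGen (1, false))⁻¹ * (swap02InvGen (1, true))⁻¹ *
    (swap02InvGen (2, false) * swap02InvGen (2, true) * (swap02InvGen (2, false))⁻¹ *
    (swap02InvGen (2, true))⁻¹)) = 1 := by
  have h := rel_S
  simp only [hc] at h ⊢
  -- the word equals `[a₁,b₁][a₂,b₂][a₀,b₀]`, a conjugate of the relator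
  calc _ = (SurfaceGroup.a 0 * SurfaceGroup.b 0 * (SurfaceGroup.a 0)⁻¹ * (SurfaceGroup.b 0)⁻¹)⁻¹ *
        (SurfaceGroup.a 0 * SurfaceGroup.b 0 * (SurfaceGroup.a 0)⁻¹ * (SurfaceGroup.b 0)⁻¹ *
          (SurfaceGroup.a 1 * SurfaceGroup.b 1 * (SurfaceGroup.a 1)⁻¹ * (SurfaceGroup.b 1)⁻¹ *
            (SurfaceGroup.a 2 * SurfaceGroup.b 2 * (SurfaceGroup.a 2)⁻¹ * (SurfaceGroup.b 2)⁻¹))) *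
        (SurfaceGroup.a 0 * SurfaceGroup.b 0 * (SurfaceGroup.a 0)⁻¹ * (SurfaceGroup.b 0)⁻¹) := by
          simp only [swap02InvGen, hc]; group
    _ = 1 := by rw [h]; group

theorem swap01Gen_rel : swap01Gen (0, false) * swap01Gen (0, true) * (swap01Gen (0, false))⁻¹ *
    (swap01Gen (0, true))⁻¹ * (swap01Gen (1, false) * swap01Gen (1, true) *
    (swap01Gen (1, false))⁻¹ * (swap01Gen (1, true))⁻¹ * (swap01Gen (2, false) *
    swap01Gen (2, true) * (swap01Gen (2, false))⁻¹ * (swap01Gen (2, true))⁻¹)) = 1 := by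
  have h := rel_S
  simp only [hc] at h ⊢
  -- the word equals `[a₁,b₁][a₂,b₂][a₀,b₀]`
  calc _ = (SurfaceGroup.a 0 * SurfaceGroup.b 0 * (SurfaceGroup.a 0)⁻¹ * (SurfaceGroup.b 0)⁻¹)⁻¹ *
        (SurfaceGroup.a 0 * SurfaceGroup.b 0 * (SurfaceGroup.a 0)⁻¹ * (SurfaceGroup.b 0)⁻¹ *
          (SurfaceGroup.a 1 * SurfaceGroup.b 1 * (SurfaceGroup.a 1)⁻¹ * (SurfaceGroup.b 1)⁻¹ *
            (SurfaceGroup.a 2 * SurfaceGroup.b 2 * (SurfaceGroup.a 2)⁻¹ * (SurfaceGroup.b 2)⁻¹))) *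
        (SurfaceGroup.a 0 * SurfaceGroup.b 0 * (SurfaceGroup.a 0)⁻¹ * (SurfaceGroup.b 0)⁻¹) := by
          simp only [swap01Gen, hc]; group
    _ = 1 := by rw [h]; group

theorem swap01InvGen_rel : swap01InvGen (0, false) * swap01InvGen (0, true) *
    (swap01InvGen (0, false))⁻¹ * (swap01InvGen (0, true))⁻¹ * (swap01InvGen (1, false) *
    swap01InvGen (1, true) * (swap01InvGen (1, false))⁻¹ * (swap01InvGen (1, true))⁻¹ *
    (swap01InvGen (2, false) * swap01InvGen (2, true) * (swap01InvGen (2, false))⁻¹ *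
    (swap01InvGen (2, true))⁻¹)) = 1 := by
  have h := rel_S
  simp only [hc] at h ⊢
  -- the word equals `[a₁,b₁] · relator · [a₁,b₁]⁻¹`
  calc _ = (SurfaceGroup.a 1 * SurfaceGroup.b 1 * (SurfaceGroup.a 1)⁻¹ * (SurfaceGroup.b 1)⁻¹) *
        (SurfaceGroup.a 0 * SurfaceGroup.b 0 * (SurfaceGroup.a 0)⁻¹ * (SurfaceGroup.b 0)⁻¹ *
          (SurfaceGroup.a 1 * SurfaceGroup.b 1 * (SurfaceGroup.a 1)⁻¹ * (SurfaceGroup.b 1)⁻¹ *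
            (SurfaceGroup.a 2 * SurfaceGroup.b 2 * (SurfaceGroup.a 2)⁻¹ * (SurfaceGroup.b 2)⁻¹))) *
        (SurfaceGroup.a 1 * SurfaceGroup.b 1 * (SurfaceGroup.a 1)⁻¹ * (SurfaceGroup.b 1)⁻¹)⁻¹ := by
          simp only [swap01InvGen, hc]; group
    _ = 1 := by rw [h]; group

/-- **Handle swap `0 ↔ 2`**, an automorphism of `S₃` with `a₂ ↦ a₀` (so `a₃` is a "curve"). -/
def swap02 : S ≃* S :=
  MonoidHom.toMulEquiv (endOfGens swap02Gen swap02Gen_rel) (endOfGens swap02InvGen swap02InvGen_rel)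
    (PresentedGroup.ext fun p => by
      rcases p with ⟨k, s⟩
      fin_cases k <;> cases s <;>
        simp [swap02Gen, swap02InvGen, hc, SurfaceGroup.a, SurfaceGroup.b] <;> group)
    (PresentedGroup.ext fun p => by
      rcases p with ⟨k, s⟩
      fin_cases k <;> cases s <;>
        simp [swap02Gen, swap02InvGen, hc, SurfaceGroup.a, SurfaceGroup.b] <;> group)

/-- **Handle swap `0 ↔ 1`**, an automorphism of `S₃` with `a₁ ↦ a₀` (so `a₂` is a "curve"). -/
def swap01 : S ≃* S :=
  MonoidHom.toMulEquiv (endOfGens swap01Gen swap01Gen_rel) (endOfGens swap01InvGen swap01InvGen_rel)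
    (PresentedGroup.ext fun p => by
      rcases p with ⟨k, s⟩
      fin_cases k <;> cases s <;>
        simp [swap01Gen, swap01InvGen, hc, SurfaceGroup.a, SurfaceGroup.b] <;> group)
    (PresentedGroup.ext fun p => by
      rcases p with ⟨k, s⟩
      fin_cases k <;> cases s <;>
        simp [swap01Gen, swap01InvGen, hc, SurfaceGroup.a, SurfaceGroup.b] <;> group)

theorem swap02_a2 : swap02 (SurfaceGroup.a 2) = SurfaceGroup.a 0 := by
  simp [swap02, SurfaceGroup.a, swap02Gen]

theorem swap01_a1 : swap01 (SurfaceGroup.a 1) = SurfaceGroup.a 0 := by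
  simp [swap01, SurfaceGroup.a, swap01Gen]

theorem isCurve_a0 : IsCurve (SurfaceGroup.a 0) := ⟨MulEquiv.refl _, rfl⟩

theorem isCurve_a1 : IsCurve (SurfaceGroup.a 1) := ⟨swap01, swap01_a1⟩

theorem isCurve_a2 : IsCurve (SurfaceGroup.a 2) := ⟨swap02, swap02_a2⟩

/-- The three reference curves are curves. -/
theorem isCurve_loneRef (i : Fin 3) : IsCurve (loneRef i) := by
  fin_cases i
  · exact isCurve_a2
  · exact isCurve_a1
  · exact isCurve_a0

/-- Curves are carried to curves by automorphisms. -/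
theorem IsCurve.map {c : S} (h : IsCurve c) (φ : S ≃* S) : IsCurve (φ c) := by
  obtain ⟨ψ, hψ⟩ := h
  exact ⟨φ.symm.trans ψ, by simp [hψ]⟩

/-- The reference curve of lone slot `i` lies in the other two standard kernels. -/
theorem loneRef_mem {i l : Fin 3} (h : l ≠ i) : loneRef i ∈ N l := by
  fin_cases i <;> fin_cases l <;>
    first
    | exact absurd rfl h
    | exact of_mem_s4Kernels _ (by decide)

/-- Automorphisms carry surgered subgroups to surgered subgroups. -/
theorem surgered_map (φ : S ≃* S) (K : TrisectionKernels 3) (i : Fin 3) (c : S) :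
    (surgered K i c).map φ.toMonoidHom = surgered (fun l => (K l).map φ.toMonoidHom) i (φ c) := by
  unfold surgered
  rw [Subgroup.map_normalClosure _ _ φ.surjective, Set.image_union, Set.image_singleton,
    Subgroup.coe_map]
  rfl

/-- NON-VACUITY: the standard triple satisfies every hypothesis and the surgered-shadow conclusion
(with the identity automorphism). -/
theorem standard_witness (i : Fin 3) :
    PairsNormalised N ∧ TripleShadowsStandard N ∧ SurgeredShadowsStandard i N (loneRef i) :=
  ⟨fun i j _ => ⟨MulEquiv.refl _, by simp, by simp⟩, fun M _ _ => ⟨MulEquiv.refl _, fun i => by simp⟩,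
    fun M _ _ => ⟨MulEquiv.refl _, by simp⟩⟩

/-- NECESSITY of the conclusion of `stub_hullCoherence`: it holds whenever `Iso N K` does
(take `c' = φ(loneRef i)` and `ψ = φ` at every level). -/
theorem surgeredShadows_of_iso {K : TrisectionKernels 3} (h : TrisectionKernels.Iso N K) (i : Fin 3) :
    ∃ c' : S, IsCurve c' ∧ (∀ l : Fin 3, l ≠ i → c' ∈ K l) ∧ SurgeredShadowsStandard i K c' := by
  obtain ⟨φ, hφ⟩ := h
  have hK : (fun l => (N l).map φ.toMonoidHom) = K := funext hφ
  refine ⟨φ (loneRef i), (isCurve_loneRef i).map φ, fun l hl => ?_, fun M hM _ => ⟨φ, ?_⟩⟩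
  · rw [← hφ l]
    exact Subgroup.mem_map.mpr ⟨_, loneRef_mem hl, rfl⟩
  · rw [Subgroup.map_sup, (Subgroup.characteristic_iff_map_eq.mp hM) φ, surgered_map, hK]

/-- NECESSITY of the conclusion of `stub_weaklyReducible`: `Iso N K` makes `K` weakly reducible
(transport the standard weak reduction `a₁ ∈ N 0`, `a₃ ∈ N 1 ⊓ N 2`). -/
theorem isWeaklyReducible_of_iso {K : TrisectionKernels 3} (h : TrisectionKernels.Iso N K) :
    IsWeaklyReducible K := by
  obtain ⟨φ, hφ⟩ := h
  refine ⟨0, 1, 2, by decide, by decide, by decide, φ (SurfaceGroup.a 0), φ (SurfaceGroup.a 2),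
    ?_, ?_, ?_, isCurve_a0.map φ, isCurve_a2.map φ, ?_⟩
  · rw [← hφ 0]; exact Subgroup.mem_map.mpr ⟨_, of_mem_s4Kernels 0 (by decide), rfl⟩
  · rw [← hφ 1]; exact Subgroup.mem_map.mpr ⟨_, of_mem_s4Kernels 1 (by decide), rfl⟩
  · rw [← hφ 2]; exact Subgroup.mem_map.mpr ⟨_, of_mem_s4Kernels 2 (by decide), rfl⟩
  · refine ⟨φ.symm, by simp, 1, ?_⟩
    simp only [one_mul, inv_one, mul_one, MulEquiv.symm_apply_apply]
    exact Subgroup.subset_closure (by simp)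

/-- CERTIFICATE: the genus-3 gate (the crux's conclusion pattern at `m = 0`) implies both open
stubs — `stub_weaklyReducible` and `stub_hullCoherence` are NECESSARY for the crux. -/
theorem open_stubs_necessary
    (gate : ∀ K : TrisectionKernels 3, IsGroupTrisection 3 1 (PUnit : Type) K →
      PairsNormalised K → TripleShadowsStandard K → TrisectionKernels.Iso N K) :
    WeakReduction ∧ HullCoherence :=
  ⟨fun K hK hW hS => isWeaklyReducible_of_iso (gate K hK hW hS),
    fun K i _ hK hW hS _ => surgeredShadows_of_iso (gate K hK hW hS) i⟩

end Certificates

end Summit.SmoothPoincare4.SmoothPoincare4.Cruxes.ShadowApproximation.WeaklyReducibleKnotRigidity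

end
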